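import Mathlib
import HarnessLib
import Summits.ResolutionOfSingularities.ResolutionOfSingularities.Theorems.WildQuotientsWildQuotientResolutionS1aKillShift

/-!
# W4.5c — K-UNIQ SIG v2: the kill ray is the LEAST admissible ray (K-ULP), support uniqueness (K-ULP-S),
# and the frame-free uniqueness target (K-U)

[OURS · L1 W4.5c · res-L1-w45c-plan-1 g14 · counted 0 · signatures only (sorries intentional); NOT a statement of any manuscript.]
Crux `stmt-ResolutionOfSingularities-17941` `CyclicQuotientFourfolds`, line `s1a-logminvertex` v10, K-side (`stub_killTouchReachAux`).
Companion memo: `Cruxes/CyclicQuotientFourfolds/Lines/s1a-logminvertex-K-UNIQ-v1.md`.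

* §1 the ADMISSIBLE POLYHEDRON of a frame: rows `⟨r, a⟩ ≥ r_t + 1` (`t = none`: a weight-0 row), `Admissible`, and the
  vertex-irrelevance witnesses `PurePowerTight` (for every centre variable `i` some row contains the pure power `x_i^m`, tight at `r`);
* §2 **K-ULP** `least_of_purePowerTight`: such an `r` is componentwise BELOW every admissible `r'` (so per frame and support there is at most
  ONE kill ray, = the least element of the polyhedron; U-OBS / K-UNIQ-BOX of THETA-LP-CENSUS v10 box-free); **K-ULP-S** `not_admissible_of_nonpos`:
  no admissible ray vanishes at a centre variable (at most ONE support kills per frame);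
* §3 **K-LEAST** `weightedFiltration_le_of_kill_of_admissible` (HAND-PROVED in K-UNIQ memo v2 §A, v2 of this file; to be kernel-checked): the
  normalised filtration of an IRRELEVANT σ-admissible weighted centre `(f, w, δ)` is BELOW (ideals contained in) the normalised filtration of every
  σ-admissible weighted centre `(f', w', δ')` with `(f) ≤ (f')`, `f'` regular and `B ⧸ (f')` reduced: `n·δ ≤ k·δ' ⇒ 𝒥_k(f,w) ≤ 𝒥_n(f',w')`.
  Frame-free form of K-ULP (proof: the homogeneous ideal `𝔮 = ⊕ₘ (𝒥ₘ ∩ {ord' > λ m δ'/δ}) mod 𝒥ₘ₊₁` of `gr_𝒥(B)` contains the initial ideal of `θ`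
  but not the powers of `in f_{i₀}`, against irrelevance);
* §4 **K-U** `weightedFiltration_veronese_eq_of_kills` (corollary of §3 applied both ways): two irrelevant σ-admissible weighted centres with the same
  centre ideal define the same Rees filtration up to Veronese: `𝒥_{kδ}(f,w) = 𝒥_{kδ'}(f',w')` — the agreement clause of
  `exists_isPrincipalCentre_touch_of_certCover` (p639213) / `…_of_nodeCertCover` (p639895) for irrelevant kill charts with a common centre, after
  scaling each chart to a common shift; (2,1) leaf case = `weightedFiltration_eq_of_leaf` (p638258). Census v11 (kit j310401) K-UF scan = numerical shadow.
-/

noncomputable section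

open Literature.AlgebraicGeometry.Resolution
open scoped LaurentPolynomial
open LaurentPolynomial
open Summit.ResolutionOfSingularities.ResolutionOfSingularities.Theorems.WildQuotientResolution.S1.CoarseChart

namespace Summit.ResolutionOfSingularities.ResolutionOfSingularities.Theorems.WildQuotientResolution.S1.KUniqSig

/-! ## §1 The admissible polyhedron of a frame -/

/-- A ROW of the admissible polyhedron of a σ-adapted frame with centre-variable set `ι`: the exponent vector `a : ι → ℕ` of a monomial of
`θ(x_t)` on the CENTRE variables, and `t : Option ι` = the centre variable whose weight is subtracted (`none` for a weight-0 coordinate or a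
frame row `θ(e)/e`). The constraint at a ray `r` (shift normalised to 1) is `⟨r, a⟩ ≥ r_t + 1`. [OURS · L1 W4.5c] -/
abbrev Row (ι : Type) := (ι → ℕ) × Option ι

variable {ι : Type} [Fintype ι] [DecidableEq ι]

/-- the subtracted weight of a row at the ray `r`: `r t`, or `0` for a weight-0 row. [OURS · L1 W4.5c] -/
def Row.target (r : ι → ℚ) (ρ : Row ι) : ℚ := (ρ.2.map r).getD 0

/-- `r` is ADMISSIBLE for the row set `R` (the census LP constraints `v_w(θ x_t) ≥ w_t + δ`, rays `r = w/δ`). [OURS · L1 W4.5c] -/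
def Admissible (R : Set (Row ι)) (r : ι → ℚ) : Prop :=
  ∀ ρ ∈ R, Row.target r ρ + 1 ≤ ∑ i, r i * (ρ.1 i : ℚ)

/-- VERTEX-IRRELEVANCE WITNESSES: for every centre variable `i` some row of `R` IS the pure power `x_i^m` and is TIGHT at `r`. (Irrelevance of the
shifted initial ideal at the coordinate point `e_i` of the exceptional divisor forces exactly this.) [OURS · L1 W4.5c] -/
def PurePowerTight (R : Set (Row ι)) (r : ι → ℚ) : Prop :=
  ∀ i, ∃ ρ ∈ R, ∃ m : ℕ, ρ.1 = Pi.single i m ∧ (m : ℚ) * r i = Row.target r ρ + 1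

/-! ## §2 K-ULP and K-ULP-S -/

/-- ★★ **K-ULP — THE KILL RAY IS THE LEAST ADMISSIBLE RAY.** If `r > 0` has pure-power tight witnesses in `R`, then every `R`-admissible `r'`
satisfies `r ≤ r'` componentwise. Proof (by hand, K-UNIQ memo v1 §2): let `λ = minᵢ r'ᵢ/rᵢ` be attained at `i₀` and suppose `λ < 1`; the witness row
of `i₀` is `(m·e_{i₀}, t)` with `m r_{i₀} = r_t + 1`; admissibility of `r'` on it gives `m r'_{i₀} ≥ r'_t + 1 ≥ λ r_t + 1`, while
`m r'_{i₀} = λ (r_t + 1)`; hence `λ ≥ 1`. (`t = none`: `λ = m r'_{i₀} ≥ 1` directly.) Consequence: per (frame, support) at most ONE kill ray.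
[OURS · L1 W4.5c · K-UNIQ v1; NOT a statement of the manuscript] -/
theorem least_of_purePowerTight (R : Set (Row ι)) (r r' : ι → ℚ) (hr : ∀ i, 0 < r i)
    (hR : PurePowerTight R r) (hr' : Admissible R r') : ∀ i, r i ≤ r' i := by
  sorry

/-- ★ **K-ULP-S — AT MOST ONE SUPPORT KILLS.** With pure-power tight witnesses at `r > 0`, no admissible `r'` has a non-positive coordinate: a
weighting supported on a proper subset of the centre variables (a BIGGER support variety in the same frame) is never admissible.
[OURS · L1 W4.5c · K-UNIQ v1; corollary of `least_of_purePowerTight`] -/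
theorem not_admissible_of_nonpos (R : Set (Row ι)) (r r' : ι → ℚ) (hr : ∀ i, 0 < r i)
    (hR : PurePowerTight R r) (i₀ : ι) (h0 : r' i₀ ≤ 0) : ¬ Admissible R r' := by
  sorry

/-! ## §3 K-LEAST — the kill filtration is the least admissible filtration (frame-free K-ULP; hand-proved, K-UNIQ v2 §A) -/

universe u

/-- ★★★ **K-LEAST.** Let `β` be a non-zero-divisor, `(f, w, δ)` (`δ > 0`) a weighted centre that is σ-admissible ((a′)_δ) with IRRELEVANT shifted
initial ideal ((i)_δ of KC3_δ), and `(f', w', δ')` any σ-admissible ((a′)_δ') weighted centre with `f'` a regular sequence, `B ⧸ (f')` reduced, positive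
weights and `(f) ≤ (f')` (its centre is contained in the kill centre). Then the normalised kill filtration is the SMALLER one:
`n·δ ≤ k·δ' ⇒ 𝒥_k(f,w) ≤ 𝒥_n(f',w')`. Proof (K-UNIQ v2 §A): with `λ = min_t ord'(f_t)·δ/(w_t δ')` one has `ord' ≥ λ·(δ'/δ)·ord` on `B`; if `λ < 1`
the classes `𝔮ₘ` of `𝒥ₘ(f,w) ∩ {ord' > λ m δ'/δ}` form a homogeneous ideal of `gr_𝒥(B) = R^w/(s)` containing the image of `(aug σ_R : β s^δ)` (by (a′)_δ'
and `λ < 1`) hence, by (i)_δ, a power of `in(f_{i₀})` — but `ord'(f_{i₀}^N) = N·ord'(f_{i₀}) = λ N w_{i₀} δ'/δ` exactly (reduced `gr'`), contradiction.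
No regularity is needed on `f`. [OURS · L1 W4.5c · K-UNIQ v2; NOT a statement of the manuscript] -/
theorem weightedFiltration_le_of_kill_of_admissible {B : Type u} [CommRing B] [IsNoetherianRing B] (σ : B ≃+* B) (β : B)
    (hβ : β ∈ nonZeroDivisors B) {p : ℕ} (hp : 0 < p) (hσp : ∀ x : B, (⇑σ)^[p] x = x)
    {c c' : ℕ} (f : Fin c → B) (f' : Fin c' → B) (w : Fin c → ℕ) (w' : Fin c' → ℕ) (δ δ' : ℕ) (hδ : 0 < δ)
    (hw' : ∀ i, 0 < w' i) (hI : Ideal.span (Set.range f) ≤ Ideal.span (Set.range f'))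
    (hreg' : RingTheory.Sequence.IsRegular B (List.ofFn f')) (hred' : IsReduced (B ⧸ Ideal.span (Set.range f')))
    (hσJ : ∀ n : ℕ, ((weightedFiltration f w).ideal n).map (σ : B →+* B) ≤ (weightedFiltration f w).ideal n)
    (hadm : ∀ (n : ℕ) (y : B), y ∈ (weightedFiltration f w).ideal n →
      σ y - y ∈ Ideal.span {β} * (weightedFiltration f w).ideal (n + δ))
    (hirr : ∃ N : ℕ, cobordantAlgebra.vertexIdeal f w ^ N ≤
      (augmentationIdeal (sigmaR σ f w hσJ hp hσp)).colon
          (Ideal.span {algebraMap B (↥(cobordantAlgebra f w)) β * cobordantAlgebra.s f w ^ δ}) ⊔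
        cobordantAlgebra.excIdeal f w)
    (hadm' : ∀ (n : ℕ) (y : B), y ∈ (weightedFiltration f' w').ideal n →
      σ y - y ∈ Ideal.span {β} * (weightedFiltration f' w').ideal (n + δ'))
    (n k : ℕ) (hnk : n * δ ≤ k * δ') :
    (weightedFiltration f w).ideal k ≤ (weightedFiltration f' w').ideal n := by
  sorry

/-! ## §4 K-U — frame-free uniqueness of the kill filtration (corollary of §3) -/

/-- ★★★ **K-U.** Two weighted centres `(f, w, δ)`, `(f', w', δ')` with the SAME centre ideal, regular with reduced quotient, both σ-admissible for the
boundary `β` and both with IRRELEVANT shifted initial ideal define the same Rees filtration up to Veronese: `𝒥_{kδ}(f,w) = 𝒥_{kδ'}(f',w')`. (§3 both ways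
with `(n,k) = (kδ', kδ)`.) Known special case: the (2,1) leaf `weightedFiltration_eq_of_leaf` (p638258). [OURS · L1 W4.5c · K-UNIQ v2; NOT a statement of
the manuscript] -/
theorem weightedFiltration_veronese_eq_of_kills {B : Type u} [CommRing B] [IsNoetherianRing B] (σ : B ≃+* B) (β : B)
    (hβ : β ∈ nonZeroDivisors B) {p : ℕ} (hp : 0 < p) (hσp : ∀ x : B, (⇑σ)^[p] x = x)
    {c c' : ℕ} (f : Fin c → B) (f' : Fin c' → B) (w : Fin c → ℕ) (w' : Fin c' → ℕ) (δ δ' : ℕ) (hδ : 0 < δ) (hδ' : 0 < δ')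
    (hw : ∀ i, 0 < w i) (hw' : ∀ i, 0 < w' i)
    (hI : Ideal.span (Set.range f') = Ideal.span (Set.range f))
    (hreg : RingTheory.Sequence.IsRegular B (List.ofFn f)) (hreg' : RingTheory.Sequence.IsRegular B (List.ofFn f'))
    (hred : IsReduced (B ⧸ Ideal.span (Set.range f)))
    (hσJ : ∀ n : ℕ, ((weightedFiltration f w).ideal n).map (σ : B →+* B) ≤ (weightedFiltration f w).ideal n)
    (hσJ' : ∀ n : ℕ, ((weightedFiltration f' w').ideal n).map (σ : B →+* B) ≤ (weightedFiltration f' w').ideal n)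
    (hadm : ∀ (n : ℕ) (y : B), y ∈ (weightedFiltration f w).ideal n →
      σ y - y ∈ Ideal.span {β} * (weightedFiltration f w).ideal (n + δ))
    (hadm' : ∀ (n : ℕ) (y : B), y ∈ (weightedFiltration f' w').ideal n →
      σ y - y ∈ Ideal.span {β} * (weightedFiltration f' w').ideal (n + δ'))
    (hirr : ∃ N : ℕ, cobordantAlgebra.vertexIdeal f w ^ N ≤
      (augmentationIdeal (sigmaR σ f w hσJ hp hσp)).colon
          (Ideal.span {algebraMap B (↥(cobordantAlgebra f w)) β * cobordantAlgebra.s f w ^ δ}) ⊔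
        cobordantAlgebra.excIdeal f w)
    (hirr' : ∃ N : ℕ, cobordantAlgebra.vertexIdeal f' w' ^ N ≤
      (augmentationIdeal (sigmaR σ f' w' hσJ' hp hσp)).colon
          (Ideal.span {algebraMap B (↥(cobordantAlgebra f' w')) β * cobordantAlgebra.s f' w' ^ δ'}) ⊔
        cobordantAlgebra.excIdeal f' w') (k : ℕ) :
    (weightedFiltration f w).ideal (k * δ) = (weightedFiltration f' w').ideal (k * δ') := by
  have hred' : IsReduced (B ⧸ Ideal.span (Set.range f')) := by rw [hI]; exact hred
  refine le_antisymm ?_ ?_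
  · exact weightedFiltration_le_of_kill_of_admissible σ β hβ hp hσp f f' w w' δ δ' hδ hw' hI.ge hreg' hred' hσJ hadm hirr hadm'
      (k * δ') (k * δ) (by rw [Nat.mul_right_comm])
  · exact weightedFiltration_le_of_kill_of_admissible σ β hβ hp hσp f' f w' w δ' δ hδ' hw hI.le hreg hred hσJ' hadm' hirr' hadm
      (k * δ) (k * δ') (by rw [Nat.mul_right_comm])

end Summit.ResolutionOfSingularities.ResolutionOfSingularities.Theorems.WildQuotientResolution.S1.KUniqSig

end
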